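import Summits.BirchSwinnertonDyer.BirchSwinnertonDyer.Theorems.GoldfeldAllTwistsTwoConverseTwinAdditiveTwoPrimesTwistHalvabilityPOneAlpha
import Summits.BirchSwinnertonDyer.BirchSwinnertonDyer.Theorems.GoldfeldAllTwistsTwoConverseTwinAdditiveTwoPrimesTwistHalvabilityPlusPFiveAlpha
import Summits.BirchSwinnertonDyer.BirchSwinnertonDyer.Theorems.GoldfeldAllTwistsTwoConverseTwinAdditiveTwoPrimesTwistSelmerPFiveTwoAdic
import Summits.BirchSwinnertonDyer.BirchSwinnertonDyer.Theorems.GoldfeldAllTwistsTwoConverseTwinAdditiveTwoPrimesTwistSelmerDualPlusPFive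
import HarnessLib

set_option linter.dupNamespace false -- namespace `…BirchSwinnertonDyer.BirchSwinnertonDyer…` is the cell's (D-0017 nested layout)
set_option autoImplicit false

/-!
# B5⁺ tranche F_β⁺, file Fβ⁺-5a: `…TwinAdditiveTwoPrimesTwistHalvabilityPlusPFive` — THE HALVABILITY VALUE `k = 1` on `q ≡ 7 (8)`, `(q/7) = −1`;
# `p ≡ 5 (8)`, `(−7/p) = +1`; **`(p/q) = +1`** — TYPE-FREE (b75+ ∪ a75+), FACT-FREE Mordell–Weil algebra

Cell `bsd-goldfeld`, seat `bsd-goldfeld-s1p-c3x` (gen 16); planner ORDER (cccxciii) «OBJECT B5⁺», tranche F_β⁺. TWIN of F⁺-2b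
`…TwinAdditiveTwoPrimesTwistHalvabilityPlusPFiveAlpha` (a75+, p699065) with the E-side Selmer bound replaced by the TYPE-FREE Fβ⁺-1
`twoIsogenySelmerGroup_twoPrimesTwist_subset_pair_pFiveTwoAdic` (`S ⊆ {1, 7}`); E′-side `S′ ⊆ {1, −7, −q, 7q}` is D⁺-7's type-free
`twoIsogenySelmerGroup'_twoPrimesTwist_subset_plusPFive` as before; binder `hα` dropped everywhere. `E = ⟨0, −42qp, 0, 448q²p², 0⟩`, `K` imaginary quadratic
with `d_K = −8qp`: for ANY elliptic `W/ℚ` with `C • W = X₀(49)^{(−2qp)}` of rank one, NOT every `y ∈ W(ℚ)` is halvable in `W(K)` up to torsion — the `k = 1`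
input of the F_β⁺ closer. `--supports stmt-BirchSwinnertonDyer-19140 --as helper`. FACT-FREE: no print binder, no definition, no `sorry`. HONEST FRAMING:
Mordell–Weil algebra; nothing about `L`-values; twist-density ZERO; item 19140 stays open; BSD is not proved by any of this.

References: [SilvermanTate2015] §3.4–3.6; [SilvermanAEC2009] III.4.5, X.4.9, Exercise 10.16.
-/


noncomputable section

open scoped Classical

open WeierstrassCurve Literature.NumberTheory.EllipticCurves Literature.NumberTheory.EllipticCurves.ModularForms
  WeierstrassCurve.QuadraticDescent
open WeierstrassCurve.Affine (sqClass sqClass_mul sqClass_eq_one_iff)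

namespace Summit.BirchSwinnertonDyer.BirchSwinnertonDyer.Theorems.GoldfeldGoodTwists

/-! ## Cells b75+ ∪ a75+: `E = ⟨0, −42qp, 0, 448q²p², 0⟩`, `E′ = ⟨0, 84qp, 0, −28q²p², 0⟩`, `K = ℚ(√−2qp)`, any type -/

section HalvabilityB7Plus

variable {K : Type} [Field K] [NumberField K] {q p : ℕ} [Fact q.Prime] [Fact p.Prime]

omit [Field K] [NumberField K] in
/-- Squarefree integers with the same square class in `ℚ^×/ℚ^{×2}` are equal (tree `eq_of_squarefree_of_mul_eq_sq`). [folklore] -/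
private theorem eq_of_squarefree_of_sqClass_intCast_eq_plusPFive {d₁ d₂ : ℤ} (h₁ : Squarefree d₁) (h₂ : Squarefree d₂)
    (he : sqClass (d₁ : ℚ) = sqClass (d₂ : ℚ)) : d₁ = d₂ := by
  have h0₁ : (d₁ : ℚ) ≠ 0 := by exact_mod_cast h₁.ne_zero
  have h0₂ : (d₂ : ℚ) ≠ 0 := by exact_mod_cast h₂.ne_zero
  have h1 : sqClass ((d₁ : ℚ) * d₂) = 1 := by rw [sqClass_mul h0₁ h0₂, he, Affine.SqUnits.mul_self]
  obtain ⟨u, hu⟩ := (sqClass_eq_one_iff (mul_ne_zero h0₁ h0₂)).mp h1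
  obtain ⟨m, hm⟩ : IsSquare (d₁ * d₂) := by
    rw [← Rat.isSquare_intCast_iff]
    exact ⟨u, by push_cast; rw [hu, pow_two]⟩
  exact eq_of_squarefree_of_mul_eq_sq h₁ h₂ (m := m) (by rw [hm, pow_two])

omit [Field K] [NumberField K] in
/-- `c·t²` and `c` have the same square class (`t ≠ 0`, `c ≠ 0`). [folklore] -/
private theorem sqClass_mul_sq_eq_plusPFive {c t : ℚ} (hc : c ≠ 0) (ht : t ≠ 0) : sqClass (c * t ^ 2) = sqClass c := by
  rw [sqClass_mul hc (pow_ne_zero 2 ht), Affine.sqClass_sq, Affine.SqUnits.mul_one]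

omit [Field K] [NumberField K] in
/-- The arithmetic of C7A (as on C7): `q ≠ 2, 7`, `p ≠ 2, 7`, `q ≠ p`; `−2qp`, `14qp`, `−14qp` are squarefree. [folklore] -/
private theorem cell_arith_negTwoQP_plusPFive (hq8 : q % 8 = 7) (hq7 : jacobiSym q 7 = -1) (hp8 : p % 8 = 5) :
    (q ≠ 2 ∧ q ≠ 7 ∧ p ≠ 2 ∧ p ≠ 7 ∧ q ≠ p) ∧ Squarefree (-2 * ((q : ℤ) * p)) ∧ Squarefree (14 * ((q : ℤ) * p)) ∧
      Squarefree (-14 * ((q : ℤ) * p)) := by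
  have hq : q.Prime := Fact.out
  have hp : p.Prime := Fact.out
  obtain ⟨hq2, hq7'⟩ := ne_two_and_ne_seven_of_jacobiSym hq7
  have hp2 : p ≠ 2 := by rintro rfl; norm_num at hp8
  have hp7' : p ≠ 7 := by rintro rfl; norm_num at hp8
  have hqp : q ≠ p := by rintro rfl; omega
  have h2q : Nat.Coprime 2 q := (Nat.coprime_primes Nat.prime_two hq).mpr (Ne.symm hq2)
  have h2p : Nat.Coprime 2 p := (Nat.coprime_primes Nat.prime_two hp).mpr (Ne.symm hp2)
  have h7q : Nat.Coprime 7 q := (Nat.coprime_primes (by norm_num) hq).mpr (Ne.symm hq7')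
  have h7p : Nat.Coprime 7 p := (Nat.coprime_primes (by norm_num) hp).mpr (Ne.symm hp7')
  have hqp' : Nat.Coprime q p := (Nat.coprime_primes hq hp).mpr hqp
  have hqpS : Squarefree (q * p) := (Nat.squarefree_mul hqp').mpr ⟨hq.squarefree, hp.squarefree⟩
  have h2 : Squarefree (((2 * (q * p) : ℕ) : ℤ)) := Int.squarefree_natCast.mpr
    ((Nat.squarefree_mul (Nat.Coprime.mul_right h2q h2p)).mpr ⟨Nat.squarefree_two, hqpS⟩)
  have h14' : Squarefree (14 : ℕ) := by
    rw [show (14 : ℕ) = 2 * 7 by norm_num]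
    exact (Nat.squarefree_mul (by norm_num)).mpr ⟨Nat.squarefree_two, (by norm_num : Nat.Prime 7).squarefree⟩
  have h14 : Squarefree (((14 * (q * p) : ℕ) : ℤ)) := by
    refine Int.squarefree_natCast.mpr ((Nat.squarefree_mul ?_).mpr ⟨h14', hqpS⟩)
    rw [show (14 : ℕ) = 2 * 7 by norm_num]
    exact Nat.Coprime.mul_left (Nat.Coprime.mul_right h2q h2p) (Nat.Coprime.mul_right h7q h7p)
  refine ⟨⟨hq2, hq7', hp2, hp7', hqp⟩, h2.squarefree_of_dvd ⟨-1, by push_cast; ring⟩, by exact_mod_cast h14,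
    h14.squarefree_of_dvd ⟨-1, by push_cast; ring⟩⟩

/-- **A squarefree `c` with `[c] ∈ α(E(ℚ))` lies in the TYPE-FREE Selmer set `S ⊆ {1, 7}`** (cells b75+ ∪ a75+: `twoIsogenySelmerGroup_twoPrimesTwist_subset_pair_pFiveTwoAdic`;
Literature `range_xSqClass_subset_image_twoIsogenySelmerGroup`). [cite: SilvermanAEC2009, Prop. X.4.9] -/
theorem mem_of_xSqClass_eq_sqClass_twoPrimesTwist_plusPFive (hq8 : q % 8 = 7) (hq7 : jacobiSym q 7 = -1) (hp8 : p % 8 = 5)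
    (hp7 : legendreSym p (-7) = 1)
    [(⟨0, ((-42 * ((q : ℤ) * p) : ℤ) : ℚ), 0, ((448 * ((q : ℤ) * p) ^ 2 : ℤ) : ℚ), 0⟩ : WeierstrassCurve ℚ).IsElliptic]
    (P : (⟨0, ((-42 * ((q : ℤ) * p) : ℤ) : ℚ), 0, ((448 * ((q : ℤ) * p) ^ 2 : ℤ) : ℚ), 0⟩ : WeierstrassCurve ℚ).toAffine.Point)
    {c : ℤ} (hc : Squarefree c)
    (h : (⟨0, ((-42 * ((q : ℤ) * p) : ℤ) : ℚ), 0, ((448 * ((q : ℤ) * p) ^ 2 : ℤ) : ℚ), 0⟩ : WeierstrassCurve ℚ).xSqClass P = sqClass (c : ℚ)) :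
    c = 1 ∨ c = 7 := by
  have hq : q.Prime := Fact.out
  have hp : p.Prime := Fact.out
  have hab := hab_inertTwoTwist (m := q * p) (Nat.mul_pos hq.pos hp.pos)
  push_cast at hab
  have hsub := range_xSqClass_subset_image_twoIsogenySelmerGroup hab
  have hmem := hsub ⟨P, rfl⟩
  rw [Finset.coe_image] at hmem
  obtain ⟨d₁, hd₁, hd₁c⟩ := hmem
  rw [Finset.mem_coe] at hd₁
  have hd₁' := twoIsogenySelmerGroup_twoPrimesTwist_subset_pair_pFiveTwoAdic hq8 hq7 hp8 hp7 hd₁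
  have hsqf : Squarefree d₁ := ((mem_twoIsogenySelmerGroup_iff (left_ne_zero_of_mul hab)).mp hd₁).1
  have heq : d₁ = c := eq_of_squarefree_of_sqClass_intCast_eq_plusPFive hsqf hc (hd₁c.trans h)
  subst heq
  simpa using hd₁'

/-- **THE HALVABILITY VALUE IS `k = 1` ON THE TWO-TORSION MODEL, cell a75+ (any type).** For `q ≡ 7 (8)` prime with `(q/7) = −1`, `p ≡ 5 (8)`
prime with `(−7/p) = 1` and `(p/q) = +1`, `K` imaginary quadratic with `d_K = −8qp`, and
`E = ⟨0, −42qp, 0, 448q²p², 0⟩` of rank one: NOT every `y ∈ E(ℚ)` is divisible by `2` in `E(K)` up to torsion (F12a §1's two-sided count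
`not_forall_halvable_of_descent_twoSided`; the excluded classes `[−2qp]`, `[−14qp]` (E-side, outside `S ⊆ {1, 7}`, F12a's type-free
`mem_of_xSqClass_eq_sqClass_twoPrimesTwist_pOne`) and `[−2qp]`, `[14qp]` (E′-side, outside the TYPE-α `S′ ⊆ {1, −7, −q, 7q}` since `2p ≠ 1` and signs)). [cite: SilvermanTate2015, §3.5–3.6] [cite: SilvermanAEC2009, Prop. X.4.9 and Exercise 10.16] -/
theorem not_forall_halvable_twoTorsionModel_twoPrimesTwist_plusPFive (hK : IsImaginaryQuadratic K) (hq8 : q % 8 = 7)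
    (hq7 : jacobiSym q 7 = -1) (hp8 : p % 8 = 5) (hp7 : legendreSym p (-7) = 1)
    (hpq : jacobiSym p q = 1) (hdK : NumberField.discr K = -(8 * (q : ℤ) * p))
    [(⟨0, ((-42 * ((q : ℤ) * p) : ℤ) : ℚ), 0, ((448 * ((q : ℤ) * p) ^ 2 : ℤ) : ℚ), 0⟩ : WeierstrassCurve ℚ).IsElliptic]
    (hr : (⟨0, ((-42 * ((q : ℤ) * p) : ℤ) : ℚ), 0, ((448 * ((q : ℤ) * p) ^ 2 : ℤ) : ℚ), 0⟩ :
      WeierstrassCurve ℚ).mordellWeilRank = 1) :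
    ¬ ∀ y : (⟨0, ((-42 * ((q : ℤ) * p) : ℤ) : ℚ), 0, ((448 * ((q : ℤ) * p) ^ 2 : ℤ) : ℚ), 0⟩ : WeierstrassCurve ℚ).toAffine.Point,
      ∃ Q : ((⟨0, ((-42 * ((q : ℤ) * p) : ℤ) : ℚ), 0, ((448 * ((q : ℤ) * p) ^ 2 : ℤ) : ℚ), 0⟩ :
        WeierstrassCurve ℚ).baseChange K).toAffine.Point,
        incl K (⟨0, ((-42 * ((q : ℤ) * p) : ℤ) : ℚ), 0, ((448 * ((q : ℤ) * p) ^ 2 : ℤ) : ℚ), 0⟩ : WeierstrassCurve ℚ) y -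
          (2 : ℤ) • Q ∈ AddCommGroup.torsion _ := by
  have hq : q.Prime := Fact.out
  have hp : p.Prime := Fact.out
  obtain ⟨⟨hq2, hq7', hp2, hp7', hqp⟩, hsqf2, hsqf14, hsqfm14⟩ := cell_arith_negTwoQP_plusPFive (q := q) (p := p) hq8 hq7 hp8
  obtain ⟨h7, h7'⟩ := not_isSquare_seven_negEightTwoPrimesField hK hq hp hq7' hp7' hdK
  have hqQ : (q : ℚ) ≠ 0 := by exact_mod_cast hq.ne_zero
  have hpQ : (p : ℚ) ≠ 0 := by exact_mod_cast hp.ne_zero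
  have hqK : (q : K) ≠ 0 := by exact_mod_cast hq.ne_zero
  have hpK : (p : K) ≠ 0 := by exact_mod_cast hp.ne_zero
  have hN : 0 < (q : ℤ) * p := by have := Nat.mul_pos hq.pos hp.pos; exact_mod_cast this
  have hp0 : (p : ℤ) ≠ 0 := by exact_mod_cast hp.ne_zero
  have hqx : (q : ℤ) ≤ (q : ℤ) * p := le_mul_of_one_le_right (by positivity) (by exact_mod_cast hp.one_lt.le)
  have hq2' : (2 : ℤ) ≤ q := by exact_mod_cast hq.two_le
  have hdQ : ((NumberField.discr K : ℤ) : ℚ) = -(8 * (q : ℚ) * p) := by rw [hdK]; push_cast; ring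
  have hsq1 : sqClass ((NumberField.discr K : ℤ) : ℚ) = sqClass (((-2 * ((q : ℤ) * p) : ℤ)) : ℚ) := by
    rw [hdQ, show (-(8 * (q : ℚ) * p)) = (((-2 * ((q : ℤ) * p) : ℤ)) : ℚ) * 2 ^ 2 by push_cast; ring]
    exact sqClass_mul_sq_eq_plusPFive (by push_cast; exact mul_ne_zero (by norm_num) (mul_ne_zero hqQ hpQ)) two_ne_zero
  refine not_forall_halvable_of_descent_twoSided hK _ ?_ ?_ (fun P ↦ ⟨?_, ?_⟩) (fun P ↦ ⟨?_, ?_⟩) hr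
  · -- `a² − 4b = −7·(2qp)² ∉ K²`
    rintro ⟨r, hr'⟩
    simp only [WeierstrassCurve.baseChange, WeierstrassCurve.map_a₂, WeierstrassCurve.map_a₄, eq_ratCast] at hr'
    push_cast at hr'
    exact h7 (isSquare_of_sq_mul (k := 2 * ((q : K) * p)) (mul_ne_zero two_ne_zero (mul_ne_zero hqK hpK)) (r := r)
      (by linear_combination hr'.symm))
  · -- `b = 7·(8qp)² ∉ K²`
    rintro ⟨r, hr'⟩
    simp only [WeierstrassCurve.baseChange, WeierstrassCurve.map_a₄, eq_ratCast] at hr'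
    push_cast at hr'
    exact h7' (isSquare_of_sq_mul (k := 8 * ((q : K) * p)) (mul_ne_zero (by norm_num) (mul_ne_zero hqK hpK)) (r := r)
      (by linear_combination hr'.symm))
  · -- E-side: `[d_K] = [−2qp] ∉ S`
    rw [hsq1]
    intro h
    rcases mem_of_xSqClass_eq_sqClass_twoPrimesTwist_plusPFive hq8 hq7 hp8 hp7 P hsqf2 h with h1 | h1 <;> omega
  · -- E-side: `[b·d_K] = [−14qp] ∉ S`
    have hsq2 : sqClass ((⟨0, ((-42 * ((q : ℤ) * p) : ℤ) : ℚ), 0, ((448 * ((q : ℤ) * p) ^ 2 : ℤ) : ℚ), 0⟩ : WeierstrassCurve ℚ).a₄ *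
        ((NumberField.discr K : ℤ) : ℚ)) = sqClass (((-14 * ((q : ℤ) * p) : ℤ)) : ℚ) := by
      rw [hdQ]
      push_cast
      rw [show (448 * ((q : ℚ) * p) ^ 2) * -(8 * (q : ℚ) * p) = (-14 * ((q : ℚ) * p)) * (16 * ((q : ℚ) * p)) ^ 2 by ring]
      exact sqClass_mul_sq_eq_plusPFive (mul_ne_zero (by norm_num) (mul_ne_zero hqQ hpQ)) (mul_ne_zero (by norm_num) (mul_ne_zero hqQ hpQ))
    rw [hsq2]
    intro h
    rcases mem_of_xSqClass_eq_sqClass_twoPrimesTwist_plusPFive hq8 hq7 hp8 hp7 P hsqfm14 h with h1 | h1 <;> omega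
  · -- E′-side: `[d_K] = [−2qp] ∉ S′`
    rw [hsq1]
    intro h
    rcases mem_of_xSqClass_codomain_eq_sqClass_twoPrimesTwist_plusPFiveAlpha hq8 hq7 hp8 hp7 hpq P hsqf2 h with h1 | h1 | h1 | h1 <;> omega
  · -- E′-side: `[a′₄·d_K] = [14qp] ∉ S′`
    have hsq2 : sqClass ((⟨0, ((-42 * ((q : ℤ) * p) : ℤ) : ℚ), 0, ((448 * ((q : ℤ) * p) ^ 2 : ℤ) : ℚ), 0⟩ :
        WeierstrassCurve ℚ).twoIsogenyCodomain.a₄ * ((NumberField.discr K : ℤ) : ℚ)) = sqClass (((14 * ((q : ℤ) * p) : ℤ)) : ℚ) := by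
      rw [twoIsogenyCodomain_a₄, hdQ]
      push_cast
      rw [show ((-42 * ((q : ℚ) * p)) ^ 2 - 4 * (448 * ((q : ℚ) * p) ^ 2)) * -(8 * (q : ℚ) * p) =
        (14 * ((q : ℚ) * p)) * (4 * ((q : ℚ) * p)) ^ 2 by ring]
      exact sqClass_mul_sq_eq_plusPFive (mul_ne_zero (by norm_num) (mul_ne_zero hqQ hpQ)) (mul_ne_zero (by norm_num) (mul_ne_zero hqQ hpQ))
    rw [hsq2]
    intro h
    rcases mem_of_xSqClass_codomain_eq_sqClass_twoPrimesTwist_plusPFiveAlpha hq8 hq7 hp8 hp7 hpq P hsqf14 h with h1 | h1 | h1 | h1 <;> omega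

/-- **THE HALVABILITY VALUE IS `k = 1` ON a75+ (any type).** For `q ≡ 7 (8)` prime, `(q/7) = −1`; `p ≡ 5 (8)` prime, `(−7/p) = 1`, `−7` NOT a
fourth power mod `p`; `(p/q) = +1`; `K` imaginary quadratic with `d_K = −8qp`; ANY elliptic `W/ℚ` with `C • W = X₀(49)^{(−2qp)}` and
`rank W(ℚ) = 1`: NOT every `y ∈ W(ℚ)` is divisible by `2` in `W(K)` up to torsion (transport of
`not_forall_halvable_twoTorsionModel_twoPrimesTwist_plusPFive`, verbatim as F12a's). UNCONDITIONAL given rank one (on C7A the rank axis is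
THEOREM A⁗_α(C7A), file Z3). [cite: SilvermanTate2015, §3.5–3.6] [cite: SilvermanAEC2009, Prop. X.4.9 and Exercise 10.16] -/
theorem not_forall_halvable_twoPrimesTwist_plusPFive (hK : IsImaginaryQuadratic K) (hq8 : q % 8 = 7) (hq7 : jacobiSym q 7 = -1)
    (hp8 : p % 8 = 5) (hp7 : legendreSym p (-7) = 1) (hpq : jacobiSym p q = 1)
    (hdK : NumberField.discr K = -(8 * (q : ℤ) * p))
    (W : WeierstrassCurve ℚ) [W.IsElliptic] (C₁ : VariableChange ℚ)
    (hC₁ : C₁ • W = cm7.quadraticTwist ((-2 * ((q : ℤ) * p) : ℤ) : ℚ)) (hr : W.mordellWeilRank = 1) :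
    ¬ ∀ y : W.toAffine.Point, ∃ Q : (W.baseChange K).toAffine.Point,
        incl K W y - (2 : ℤ) • Q ∈ AddCommGroup.torsion (W.baseChange K).toAffine.Point := by
  have hq : q.Prime := Fact.out
  have hp : p.Prime := Fact.out
  -- `C • W = E`
  have hCE := (smul_eq_twoTorsionModel_of_smul_eq_quadraticTwist (-2 * ((q : ℤ) * p)) W C₁ hC₁).trans
    (show (⟨0, ((21 * (-2 * ((q : ℤ) * p)) : ℤ) : ℚ), 0, ((112 * (-2 * ((q : ℤ) * p)) ^ 2 : ℤ) : ℚ), 0⟩ :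
        WeierstrassCurve ℚ) = ⟨0, ((-42 * ((q : ℤ) * p) : ℤ) : ℚ), 0, ((448 * ((q : ℤ) * p) ^ 2 : ℤ) : ℚ), 0⟩ by
      ext <;> push_cast <;> ring)
  set C : VariableChange ℚ := ⟨(Units.mk0 (2 : ℚ) two_ne_zero)⁻¹, 2 * ((-2 * ((q : ℤ) * p) : ℤ) : ℚ), 0, 0⟩ * C₁ with hC
  haveI hE : (⟨0, ((-42 * ((q : ℤ) * p) : ℤ) : ℚ), 0, ((448 * ((q : ℤ) * p) ^ 2 : ℤ) : ℚ), 0⟩ : WeierstrassCurve ℚ).IsElliptic := by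
    rw [← hCE]; infer_instance
  -- rank transport
  have hrE : (⟨0, ((-42 * ((q : ℤ) * p) : ℤ) : ℚ), 0, ((448 * ((q : ℤ) * p) ^ 2 : ℤ) : ℚ), 0⟩ :
      WeierstrassCurve ℚ).mordellWeilRank = 1 := by
    rw [← mordellWeilRank_congr hCE, ← hr]
    have h := mordellWeilRank_variableChange_holds W C
    unfold mordellWeilRank_variableChange at h
    convert h using 2
  intro hall
  refine not_forall_halvable_twoTorsionModel_twoPrimesTwist_plusPFive hK hq8 hq7 hp8 hp7 hpq hdK hrE fun P ↦ ?_
  -- the rational point `y = C⁻¹ • P` of `W` and its hypothetical half `Q ∈ W(K)`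
  set e₀ := (VariableChange.pointEquiv W C).trans (Affine.Point.congrEquiv hCE) with he₀
  obtain ⟨Q, hQ⟩ := hall (e₀.symm P)
  -- push forward to `E(K)`
  set Φ := (VariableChange.pointEquivBaseChange W C K).trans
    (Affine.Point.congrEquiv (congrArg (fun V : WeierstrassCurve ℚ => V.baseChange K) hCE)) with hΦ
  have hΦy : Φ (incl K W (e₀.symm P)) = incl K _ P := by
    rw [hΦ, AddEquiv.trans_apply, pointEquivBaseChange_incl, congrEquiv_incl hCE]
    congr 1
    rw [he₀]
    simp only [AddEquiv.symm_trans_apply]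
    rw [AddEquiv.apply_symm_apply, AddEquiv.apply_symm_apply]
  refine ⟨Φ Q, (AddCommGroup.mem_torsion _).mpr ?_⟩
  rw [← hΦy, ← map_zsmul, ← map_sub]
  exact Φ.toAddMonoidHom.isOfFinAddOrder ((AddCommGroup.mem_torsion _).mp hQ)

end HalvabilityB7Plus

end Summit.BirchSwinnertonDyer.BirchSwinnertonDyer.Theorems.GoldfeldGoodTwists

end
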